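import Summits.Ventures.Crystal3D.Theorems.StickyWulffConstantGenericWallFloorExitCertified
import HarnessLib

/-!
# Exact local accounting for the word automaton: a move target carries a closed star, so a non-moving target has ≤ 11 contacts

HONEST FRAMING. Part of the venture `Summits/Ventures/Crystal3D` (cell `crystal3d-full`), helper for the crux
`CoaxialWallLaw` (stmt-Ventures-19481) of `route-Ventures-StickyWulffConstant`, REGISTERED line `WallLedgerF`
(planner cf-p1 gen 16), open stub `stub_coaxialTwoSlabAdhesion` (general fillings).  This is the «port of the
C12-55 accounting» to 19481-p2's v2 word automaton (memo F-FRONTIER-g5 §4(b), evidence on the crux item): in the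
NET count `word_sources_le` every END (a certified state that neither has a full shell nor reads as a twin dozen)
is paid by SOME unsaturated ball within contact distance one — multiplicity `13·M`.  With the E1 row C12-55
(`ExactOnly 0 (star s₀)`, a named hypothesis of computational grade) an end REACHED BY A FULL OR A CROSS MOVE pays
AT ITS OWN BALL: the target of such a move carries the CLOSED VERTEX STAR of `−u` in the target class's frame
(`u` the model slot of the target direction), and a ball carrying a closed star is either `≤ 11`-coordinated, or
has a full shell, or reads as a twin dozen across a normal `n` with `⟪d, n⟫ ∈ {√(2/3), 0}` — i.e. MOVES.
Rung credit only; F-C1 not moved.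

* `le_eleven_or_moving_of_closedStar` — STAR-ONLY form of 19480-p2's `exit_unsaturated_or_twinCap`: `X`
  `1`-separated, C12-55 by name, frame `A`, slot `u`, ball `e` with `e − A u ∈ X` and `e + A w ∈ X` for the four
  slots `w` with `⟪w, u⟫ = −½`.  Then `#contacts(e) ≤ 11`, or `e + A w ∈ X` for all slots, or `e` reads as a twin
  dozen of `(A, n)` (own closed half present, far slots absent with mirrors present) with `⟪A u, n⟫ = √(2/3)` or
  `= 0` (the value `−√(2/3)` is excluded by `e − A u ∈ X`).  Proof = `trichotomy_of_exactOnly` on the transported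
  star (`exactOnly_star_transport`); the full predecessor shell of the original lemma is not needed.
* `word_target_star_full`, `word_target_star_cross` — in the abstract setting of `…WordCore` (classes `K`, frames
  `F`, directions `d κ = F κ u_κ`, class change `next` with `F (next κ m) = M_m ∘ F κ` and `⟪d (next κ m), m⟫ =
  √(2/3)`): the target `(b, κ')` of a FULL move or of a CROSS move from a state at the ball `y ∈ X` satisfies
  `b − F κ' u' ∈ X` and `b + F κ' s ∈ X` for every slot `s` with `⟪s, u'⟫ = −½`, where `d κ' = F κ' u'`.  (After
  a CROSS the star of the new class consists of the reading ball, the two other mirror balls and two equatorial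
  balls; a GLIDE target carries the hcp 5-star instead — row A12-451, not treated here.)
* `word_target_le_eleven_or_moving` — combination: given C12-55, the target of a full/cross move is
  `≤ 11`-coordinated or MOVING (full shell, or a twin reading with `⟪d κ', n⟫ ∈ {√(2/3), 0}` in the mirror form
  `b + (F κ' w − 2⟪F κ' w, n⟫ n) ∈ X` for `⟪F κ' w, n⟫ < 0` used by `word_sources_le`).  Hence a reachable END pays ½
  at its own ball, with multiplicity = number of classes ending there (not `13·M`).

WHAT THIS IS NOT: not the stub; glide targets and the certification of C12-55 itself are not here; F-C1 not moved.
-/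

noncomputable section

namespace Summit.Ventures.Crystal3D.Theorems

open Summit.Ventures.Crystal3D Finset
open Literature.MathematicalPhysics.StatisticalMechanics (fccStacking)
open scoped InnerProductSpace

variable {X : Finset (EuclideanSpace ℝ (Fin 3))}

/-- The closed star of `−u` at `e` from the star hypotheses: every slot `w` with `⟪A w, A u⟫ < 0` is occupied. -/
theorem star_mem_of_inner_neg (A : EuclideanSpace ℝ (Fin 3) ≃ₗᵢ[ℝ] EuclideanSpace ℝ (Fin 3))
    {u : EuclideanSpace ℝ (Fin 3)} (hu : u ∈ fccSlots) {e : EuclideanSpace ℝ (Fin 3)}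
    (hd : e - A u ∈ X) (hstar : ∀ w ∈ fccSlots, ⟪w, u⟫_ℝ = -(1 / 2) → e + A w ∈ X)
    {w : EuclideanSpace ℝ (Fin 3)} (hw : w ∈ fccSlots) (hlt : ⟪A w, A u⟫_ℝ < 0) : e + A w ∈ X := by
  rcases (mem_closedStar_iff A hu hw).2 hlt with rfl | h
  · rw [map_neg, ← sub_eq_add_neg]; exact hd
  · refine hstar w hw ?_
    rw [inner_neg_right] at h; linarith

open scoped Classical in
/-- **Star-only exit trichotomy.**  See the module docstring. -/
theorem le_eleven_or_moving_of_closedStar (hX : ∀ p ∈ X, ∀ q ∈ X, p ≠ q → 1 ≤ dist p q)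
    {s₀ : EuclideanSpace ℝ (Fin 3)} (hs₀ : s₀ ∈ fccSlots)
    (hcert : ExactOnly 0 (fccSlots.filter fun w => 0 < ⟪w, s₀⟫_ℝ))
    (A : EuclideanSpace ℝ (Fin 3) ≃ₗᵢ[ℝ] EuclideanSpace ℝ (Fin 3))
    {u : EuclideanSpace ℝ (Fin 3)} (hu : u ∈ fccSlots) {e : EuclideanSpace ℝ (Fin 3)}
    (hd : e - A u ∈ X) (hstar : ∀ w ∈ fccSlots, ⟪w, u⟫_ℝ = -(1 / 2) → e + A w ∈ X) :
    (X.filter fun q => dist e q = 1).card ≤ 11 ∨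
    (∀ w ∈ fccSlots, e + A w ∈ X) ∨
    ∃ n : EuclideanSpace ℝ (Fin 3), ‖n‖ = 1 ∧
      (∀ w ∈ fccSlots, ⟪A w, n⟫_ℝ = 0 ∨ ⟪A w, n⟫_ℝ = Real.sqrt (2 / 3) ∨ ⟪A w, n⟫_ℝ = -Real.sqrt (2 / 3)) ∧
      (⟪A u, n⟫_ℝ = Real.sqrt (2 / 3) ∨ ⟪A u, n⟫_ℝ = 0) ∧
      (∀ w ∈ fccSlots, ⟪A w, n⟫_ℝ ≤ 0 → e + A w ∈ X) ∧
      (∀ w ∈ fccSlots, 0 < ⟪A w, n⟫_ℝ → e + A w ∉ X ∧ e - A w + (2 * ⟪A w, n⟫_ℝ) • n ∈ X) := by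
  -- the transported certificate and the star inside the shell
  have hO : ExactOnly e ((fccSlots.filter fun w => 0 < ⟪w, -u⟫_ℝ).image fun w => e + A w) :=
    exactOnly_star_transport hs₀ hcert A e (neg_mem_fccSlots hu)
  have hOsub : ((fccSlots.filter fun w => 0 < ⟪w, -u⟫_ℝ).image fun w => e + A w) ⊆
      X.filter fun q => dist e q = 1 := by
    intro x hx
    obtain ⟨w, hw, rfl⟩ := Finset.mem_image.1 hx
    obtain ⟨hwS, hpos⟩ := Finset.mem_filter.1 hw
    have hlt : ⟪A w, A u⟫_ℝ < 0 := by
      rw [LinearIsometryEquiv.inner_map_map]; rw [inner_neg_right] at hpos; linarith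
    refine Finset.mem_filter.2 ⟨star_mem_of_inner_neg A hu hd hstar hwS hlt, ?_⟩
    rw [dist_eq_norm, show e - (e + A w) = -(A w) by abel, norm_neg, LinearIsometryEquiv.norm_map,
      norm_eq_one_of_mem_fccSlots hwS]
  -- three independent occupied slots in the hemisphere of `−A u`
  have hν : A u ≠ 0 := by
    intro h
    have := norm_eq_one_of_mem_fccSlots hu
    rw [← A.norm_map, h, norm_zero] at this; exact one_ne_zero this.symm
  obtain ⟨w₁, hw₁, w₂, hw₂, w₃, hw₃, h₁, h₂, h₃, hind⟩ := exists_independent_slots_of_hemisphere A hν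
  rcases trichotomy_of_exactOnly hX A hOsub hO hw₁ hw₂ hw₃ (star_mem_of_inner_neg A hu hd hstar hw₁ h₁)
      (star_mem_of_inner_neg A hu hd hstar hw₂ h₂) (star_mem_of_inner_neg A hu hd hstar hw₃ h₃) hind with
    h11 | hall | ⟨n, hn, hmenu, hle, hgt⟩
  · exact Or.inl h11
  · exact Or.inr (Or.inl hall)
  · refine Or.inr (Or.inr ⟨n, hn, hmenu, ?_, hle, hgt⟩)
    have hrpos : 0 < Real.sqrt (2 / 3) := Real.sqrt_pos.2 (by norm_num)
    rcases hmenu u hu with h0 | hfar | hneg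
    · exact Or.inr h0
    · exact Or.inl hfar
    · exfalso
      -- `−u` would be a far slot, hence empty; but `e + A(−u) = e − A u ∈ X`
      have hs := neg_mem_fccSlots hu
      have hspos : 0 < ⟪A (-u), n⟫_ℝ := by rw [map_neg, inner_neg_left, hneg, neg_neg]; exact hrpos
      have hmem : e + A (-u) ∈ X := by rw [map_neg, ← sub_eq_add_neg]; exact hd
      exact (hgt _ hs hspos).1 hmem

section Word

variable {K : Type*} {F : K → (EuclideanSpace ℝ (Fin 3) ≃ₗᵢ[ℝ] EuclideanSpace ℝ (Fin 3))}
  {d : K → EuclideanSpace ℝ (Fin 3)} {next : K → EuclideanSpace ℝ (Fin 3) → K}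
  {W : Finset (EuclideanSpace ℝ (Fin 3) × K)}
  {f : EuclideanSpace ℝ (Fin 3) × K → EuclideanSpace ℝ (Fin 3) × K}

/-- **The target of a FULL move carries the closed star of the arrival slot.** -/
theorem word_target_star_full
    (hd : ∀ κ, ∃ u ∈ fccSlots, d κ = F κ u)
    (hf_full : ∀ v ∈ W, (∀ w ∈ fccSlots, v.1 + F v.2 w ∈ X) → f v = (v.1 + d v.2, v.2))
    {v : EuclideanSpace ℝ (Fin 3) × K} (hv : v ∈ W) (hvX : v.1 ∈ X)
    (hfull : ∀ w ∈ fccSlots, v.1 + F v.2 w ∈ X) :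
    ∃ u ∈ fccSlots, d (f v).2 = F (f v).2 u ∧ (f v).1 - F (f v).2 u ∈ X ∧
      ∀ s ∈ fccSlots, ⟪s, u⟫_ℝ = -(1 / 2) → (f v).1 + F (f v).2 s ∈ X := by
  rw [hf_full v hv hfull]
  obtain ⟨u, hu, hdu⟩ := hd v.2
  refine ⟨u, hu, hdu, ?_, ?_⟩
  · simp only; rw [hdu, add_sub_cancel_right]; exact hvX
  · intro s hs hsu
    have ht : u + s ∈ fccSlots := add_mem_fccSlots_of_inner_eq_neg_half hu hs (by rw [real_inner_comm]; exact hsu)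
    have := hfull _ ht
    simp only
    rw [hdu, add_assoc, ← map_add]; exact this

/-- **The target of a CROSS move carries the closed star of the new class.** -/
theorem word_target_star_cross
    (hd : ∀ κ, ∃ u ∈ fccSlots, d κ = F κ u)
    (hmirror : ∀ κ (m : EuclideanSpace ℝ (Fin 3)), ‖m‖ = 1 →
      (∀ w ∈ fccSlots, ⟪F κ w, m⟫_ℝ = 0 ∨ ⟪F κ w, m⟫_ℝ = Real.sqrt (2 / 3) ∨ ⟪F κ w, m⟫_ℝ = -Real.sqrt (2 / 3)) →
      ⟪d κ, m⟫_ℝ = Real.sqrt (2 / 3) → ∀ x, F (next κ m) x = F κ x - (2 * ⟪F κ x, m⟫_ℝ) • m)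
    (hdnext : ∀ κ (m : EuclideanSpace ℝ (Fin 3)), ‖m‖ = 1 →
      (∀ w ∈ fccSlots, ⟪F κ w, m⟫_ℝ = 0 ∨ ⟪F κ w, m⟫_ℝ = Real.sqrt (2 / 3) ∨ ⟪F κ w, m⟫_ℝ = -Real.sqrt (2 / 3)) →
      ⟪d κ, m⟫_ℝ = Real.sqrt (2 / 3) → ⟪d (next κ m), m⟫_ℝ = Real.sqrt (2 / 3))
    (hf_cross : ∀ v ∈ W, ∀ m : EuclideanSpace ℝ (Fin 3), ‖m‖ = 1 →
      (∀ w ∈ fccSlots, ⟪F v.2 w, m⟫_ℝ = 0 ∨ ⟪F v.2 w, m⟫_ℝ = Real.sqrt (2 / 3) ∨ ⟪F v.2 w, m⟫_ℝ = -Real.sqrt (2 / 3)) →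
      (∀ w ∈ fccSlots, ⟪F v.2 w, m⟫_ℝ ≤ 0 → v.1 + F v.2 w ∈ X) →
      (∀ w ∈ fccSlots, ⟪F v.2 w, m⟫_ℝ < 0 → v.1 + (F v.2 w - (2 * ⟪F v.2 w, m⟫_ℝ) • m) ∈ X) →
      (∀ w ∈ fccSlots, 0 < ⟪F v.2 w, m⟫_ℝ → v.1 + F v.2 w ∉ X) →
      ⟪d v.2, m⟫_ℝ = Real.sqrt (2 / 3) → f v = (v.1 + d (next v.2 m), next v.2 m))
    {v : EuclideanSpace ℝ (Fin 3) × K} (hv : v ∈ W) (hvX : v.1 ∈ X)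
    {m : EuclideanSpace ℝ (Fin 3)} (hm : ‖m‖ = 1)
    (hmenu : ∀ w ∈ fccSlots, ⟪F v.2 w, m⟫_ℝ = 0 ∨ ⟪F v.2 w, m⟫_ℝ = Real.sqrt (2 / 3) ∨ ⟪F v.2 w, m⟫_ℝ = -Real.sqrt (2 / 3))
    (hown : ∀ w ∈ fccSlots, ⟪F v.2 w, m⟫_ℝ ≤ 0 → v.1 + F v.2 w ∈ X)
    (hmir : ∀ w ∈ fccSlots, ⟪F v.2 w, m⟫_ℝ < 0 → v.1 + (F v.2 w - (2 * ⟪F v.2 w, m⟫_ℝ) • m) ∈ X)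
    (hfar : ∀ w ∈ fccSlots, 0 < ⟪F v.2 w, m⟫_ℝ → v.1 + F v.2 w ∉ X)
    (hdm : ⟪d v.2, m⟫_ℝ = Real.sqrt (2 / 3)) :
    ∃ u ∈ fccSlots, d (f v).2 = F (f v).2 u ∧ (f v).1 - F (f v).2 u ∈ X ∧
      ∀ s ∈ fccSlots, ⟪s, u⟫_ℝ = -(1 / 2) → (f v).1 + F (f v).2 s ∈ X := by
  have hr : 0 < Real.sqrt (2 / 3) := Real.sqrt_pos.2 (by norm_num)
  have hr1 : 1 / 2 < Real.sqrt (2 / 3) := by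
    rw [show (1 : ℝ) / 2 = Real.sqrt ((1 / 2) ^ 2) by rw [Real.sqrt_sq (by norm_num)]]
    exact Real.sqrt_lt_sqrt (by norm_num) (by norm_num)
  rw [hf_cross v hv m hm hmenu hown hmir hfar hdm]
  set κ' := next v.2 m with hκ'
  have hF' : ∀ x, F κ' x = F v.2 x - (2 * ⟪F v.2 x, m⟫_ℝ) • m := hmirror v.2 m hm hmenu hdm
  have hd' : ⟪d κ', m⟫_ℝ = Real.sqrt (2 / 3) := hdnext v.2 m hm hmenu hdm
  obtain ⟨u, hu, hdu⟩ := hd κ'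
  have mm : ⟪m, m⟫_ℝ = 1 := by rw [real_inner_self_eq_norm_sq, hm, one_pow]
  -- `⟪F κ u, m⟫ = −√(2/3)`
  have hum : ⟪F v.2 u, m⟫_ℝ = -Real.sqrt (2 / 3) := by
    have h1 : ⟪F κ' u, m⟫_ℝ = -⟪F v.2 u, m⟫_ℝ := by
      rw [hF' u, inner_sub_left, real_inner_smul_left, mm]; ring
    rw [← hdu, hd'] at h1; linarith
  refine ⟨u, hu, hdu, ?_, ?_⟩
  · simp only; rw [hdu, add_sub_cancel_right]; exact hvX
  · intro s hs hsu
    have ht : u + s ∈ fccSlots := add_mem_fccSlots_of_inner_eq_neg_half hu hs (by rw [real_inner_comm]; exact hsu)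
    -- `(f v).1 + F κ' s = v.1 + F κ' (u + s)`
    have e1 : v.1 + d κ' + F κ' s = v.1 + F κ' (u + s) := by rw [hdu, map_add, add_assoc]
    simp only
    rw [e1, hF' (u + s)]
    -- the menu value of `u + s`
    have hts : ⟪F v.2 (u + s), m⟫_ℝ = -Real.sqrt (2 / 3) + ⟪F v.2 s, m⟫_ℝ := by
      rw [map_add, inner_add_left, hum]
    rcases hmenu s hs with h0 | hp | hn
    · -- `⟪F κ (u+s), m⟫ = −√(2/3) < 0`: a mirror ball
      have hlt : ⟪F v.2 (u + s), m⟫_ℝ < 0 := by rw [hts, h0]; linarith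
      exact hmir _ ht hlt
    · -- `= 0`: an equatorial own ball, fixed by the mirror
      have h00 : ⟪F v.2 (u + s), m⟫_ℝ = 0 := by rw [hts, hp]; ring
      rw [h00, mul_zero, zero_smul, sub_zero]
      exact hown _ ht (le_of_eq h00)
    · -- `= −2√(2/3)`: impossible for a unit vector
      exfalso
      have hb : |⟪F v.2 (u + s), m⟫_ℝ| ≤ 1 := by
        have := abs_real_inner_le_norm (F v.2 (u + s)) m
        rwa [LinearIsometryEquiv.norm_map, norm_eq_one_of_mem_fccSlots ht, hm, one_mul] at this
      rw [hts, hn, abs_le] at hb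
      linarith [hb.1]

open scoped Classical in
/-- **Exact accounting at a full/cross target.**  Given the C12-55 row, the target `(b, κ')` of a full or a
cross move (packaged as: `b − F κ' u ∈ X` and the four other star balls present, `d κ' = F κ' u`) has
`≤ 11` contacts, or a full `F κ'`-shell, or reads as a twin dozen across a normal `n` with
`⟪d κ', n⟫ ∈ {√(2/3), 0}` (mirror form of `word_sources_le`) — i.e. it MOVES. -/
theorem word_target_le_eleven_or_moving (hX : ∀ p ∈ X, ∀ q ∈ X, p ≠ q → 1 ≤ dist p q)
    {s₀ : EuclideanSpace ℝ (Fin 3)} (hs₀ : s₀ ∈ fccSlots)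
    (hcert : ExactOnly 0 (fccSlots.filter fun w => 0 < ⟪w, s₀⟫_ℝ))
    {b : EuclideanSpace ℝ (Fin 3)} {κ' : K} {u : EuclideanSpace ℝ (Fin 3)} (hu : u ∈ fccSlots)
    (hdu : d κ' = F κ' u) (hpred : b - F κ' u ∈ X)
    (hstar : ∀ s ∈ fccSlots, ⟪s, u⟫_ℝ = -(1 / 2) → b + F κ' s ∈ X) :
    (X.filter fun q => dist b q = 1).card ≤ 11 ∨
    (∀ w ∈ fccSlots, b + F κ' w ∈ X) ∨
    ∃ n : EuclideanSpace ℝ (Fin 3), ‖n‖ = 1 ∧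
      (∀ w ∈ fccSlots, ⟪F κ' w, n⟫_ℝ = 0 ∨ ⟪F κ' w, n⟫_ℝ = Real.sqrt (2 / 3) ∨ ⟪F κ' w, n⟫_ℝ = -Real.sqrt (2 / 3)) ∧
      (∀ w ∈ fccSlots, ⟪F κ' w, n⟫_ℝ ≤ 0 → b + F κ' w ∈ X) ∧
      (∀ w ∈ fccSlots, ⟪F κ' w, n⟫_ℝ < 0 → b + (F κ' w - (2 * ⟪F κ' w, n⟫_ℝ) • n) ∈ X) ∧
      (∀ w ∈ fccSlots, 0 < ⟪F κ' w, n⟫_ℝ → b + F κ' w ∉ X) ∧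
      (⟪d κ', n⟫_ℝ = Real.sqrt (2 / 3) ∨ ⟪d κ', n⟫_ℝ = 0) := by
  rcases le_eleven_or_moving_of_closedStar hX hs₀ hcert (F κ') hu hpred hstar with h11 | hall | ⟨n, hn, hmenu, hdn, hle, hgt⟩
  · exact Or.inl h11
  · exact Or.inr (Or.inl hall)
  · refine Or.inr (Or.inr ⟨n, hn, hmenu, hle, ?_, fun w hw hp => (hgt w hw hp).1, by rw [hdu]; exact hdn⟩)
    intro w hw hlt
    have hp : 0 < ⟪F κ' (-w), n⟫_ℝ := by rw [map_neg, inner_neg_left]; linarith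
    have := (hgt (-w) (neg_mem_fccSlots hw) hp).2
    rw [map_neg, inner_neg_left, sub_neg_eq_add] at this
    have e : b + (F κ' w - (2 * ⟪F κ' w, n⟫_ℝ) • n) = b + F κ' w + (2 * -⟪F κ' w, n⟫_ℝ) • n := by
      rw [mul_neg, neg_smul]; abel
    rw [e]; exact this

end Word

end Summit.Ventures.Crystal3D.Theorems

end
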